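import Literature.NumberTheory.DiophantineGeometry.TateAlgorithmUnramifiedProofs
import Literature.NumberTheory.DiophantineGeometry.MinimalModelStepElevenProofs
import HarnessLib

/-!
# Minimal Weierstrass equations stay minimal under unramified extension of the DVR

Topic `NumberTheory/DiophantineGeometry` (companion proof file of
`Literature.NumberTheory.DiophantineGeometry.LocalReduction` / `TateAlgorithm`; theorems only).
Fifth file of the discharge of the named fact
`Literature.NumberTheory.DiophantineGeometry.kodairaSymbolAt_baseChange_of_ramificationIdx_eq_one`.

Setting: `f : R₁ →+* R₂` a ring homomorphism of discrete valuation rings mapping a uniformiser to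
a uniformiser (`f π₁ = w π₂`, `w ∈ R₂ˣ`: an UNRAMIFIED extension of complete discretely valued
fields at the level of valuation rings), `g : K₁ →+* K₂` a compatible homomorphism of the fraction
fields, perfect residue fields.

Ingredients from `MinimalModelStepElevenProofs`: §1 there = Silverman AEC VII.1.3 (b) integrality
of `r, s, t` under `v(u) ≤ 1`; §2 there = Step 11 read forwards
(`WeierstrassCurve.kodairaSymbolOfMinimal_eq_I_zero_of_pow_dvd`).

* §1 `WeierstrassCurve.integralModel_map_eq_map_integralModel_hom`, `isIntegral_map_hom` and
  **`WeierstrassCurve.isMinimal_map_of_map_uniformizer`**: a minimal equation of an elliptic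
  curve over `K₁` stays minimal over `K₂` — Silverman *AEC* Prop. VII.5.4 (a) ("`K'/K` unramified
  … Hence the original equation is also minimal over `K'`"), in EVERY residue characteristic:
  if `X.map g` were not minimal, Mathlib's `IsMinimal` yields `C = (u; r, s, t)` with
  `C • (X.map g)` integral and `v(u) < 1`; `r, s, t ∈ R₂` by AEC VII.1.3 (b) with `v(u) ≤ 1`, so the translated integral
  model has `πⁱ ∣ aᵢ`, Step 11 read forwards makes the algorithm return `I₀` on the image `f M` of the integral
  minimal model `M` of `X`, `WeierstrassCurve.kodairaSymbolOfMinimal_map_of_map_uniformizer`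
  transports this to `M`, contradicting `kodairaSymbolOfMinimal_ne_I_zero` (Step 11 is
  unreachable on a minimal equation).
* §2 `WeierstrassCurve.kodairaSymbol_map_of_map_uniformizer`,
  `WeierstrassCurve.addVal_Δ_minimal_map_of_map_uniformizer`: the Kodaira symbol and `ord Δ_min`
  over the fraction fields are unchanged (assembly as in `kodairaSymbol_map_ringEquiv` /
  `addVal_Δ_minimal_ringEquiv`: AEC VII.1.3 (b) `exists_variableChange_integralModel_eq`,
  `kodairaSymbolOfMinimal_smul`).

## Prior formalisation in the tree (x11b3-p4 lineage, `Summits/BirchSwinnertonDyer/Rank1Residual/X11b/Three/`)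

`KodairaTransportMain.kodairaSymbolOfMinimal_map_of_unif` proves the same DVR-level coupling as
`WeierstrassCurve.kodairaSymbolOfMinimal_map_of_map_uniformizer` (with `[IsLocalHom ψ]` assumed
rather than derived from `hw`); `KodairaTransportFraction.kodairaSymbol_map_of_unif` is the
fraction-field statement WITH a minimality hypothesis `hmin`; `UnramifiedMinimalDescent
.isMinimal_baseChange_of_frobenius` proves minimality persistence on a finite Galois unramified
layer of local fields by Galois descent of the non-minimality witness (no Tate's algorithm).  The
present Literature-side files exist because a Literature `_holds` cannot import `Summits/…`, and add:
minimality persistence for EVERY ring homomorphism of DVRs with `f π₁ = w π₂` and perfect residue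
fields (via Step 11 read forwards), the fraction-field statement without `hmin`, and the discharge
of the registry fact itself at arbitrary Dedekind `A ⊆ B`.

## References

* J. H. Silverman, *The Arithmetic of Elliptic Curves*, GTM 106, 2nd ed. 2009, Prop. VII.1.3 (b)
  (PDF pp. 165–166) and Prop. VII.5.4 (a) with proof.
* J. H. Silverman, *Advanced Topics in the Arithmetic of Elliptic Curves*, GTM 151, 1994, IV.9.4,
  Step 11 and proof of Cor. 9.1 ("If we start with a minimal Weierstrass equation … we never get
  to Step 11"), PDF pp. 346, 354–355.
* J. Tate, *Algorithm for determining the type of a singular fiber in an elliptic pencil*, in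
  Modular Functions of One Variable IV, LNM 476, 1975, 33–52 (`TateLNM476`; cited through
  Silverman ATAEC IV.9.4, "(Tate [2])" — the primary is not held on this hub).
-/

open Polynomial IsDedekindDomain

namespace WeierstrassCurve

open Literature.NumberTheory.DiophantineGeometry
  Literature.NumberTheory.DiophantineGeometry.TateAlgorithm
  Literature.NumberTheory.DiophantineGeometry.TateAlgorithm.Unramified

/-! ### §1 Transport of integral models and of minimality along an unramified `(f, g)` -/

section Transport

variable {R₁ K₁ R₂ K₂ : Type*}
  [CommRing R₁] [IsDomain R₁] [IsDiscreteValuationRing R₁] [Field K₁] [Algebra R₁ K₁]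
  [IsFractionRing R₁ K₁]
  [CommRing R₂] [IsDomain R₂] [IsDiscreteValuationRing R₂] [Field K₂] [Algebra R₂ K₂]
  [IsFractionRing R₂ K₂]
  (f : R₁ →+* R₂) (g : K₁ →+* K₂)
  (hc : ∀ r : R₁, g (algebraMap R₁ K₁ r) = algebraMap R₂ K₂ (f r))

open IsDiscreteValuationRing IsDedekindDomain.HeightOneSpectrum

omit [IsDomain R₁] [IsDiscreteValuationRing R₁] [IsFractionRing R₁ K₁] [IsDomain R₂]
  [IsDiscreteValuationRing R₂] [IsFractionRing R₂ K₂] in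
include hc in
/-- The square `R₁ → K₁ → K₂ = R₁ → R₂ → K₂` as an equality of ring homomorphisms. [folklore] -/
private theorem comp_algebraMap_eq_of_compat :
    g.comp (algebraMap R₁ K₁) = (algebraMap R₂ K₂).comp f := by
  ext r; exact hc r

omit [IsDomain R₁] [IsDiscreteValuationRing R₁] [IsFractionRing R₁ K₁] [IsDomain R₂]
  [IsDiscreteValuationRing R₂] [IsFractionRing R₂ K₂] in
include hc in
/-- An `R₁`-integral equation maps to an `R₂`-integral equation along compatible
`(f, g) : (R₁ ⊆ K₁) → (R₂ ⊆ K₂)` (an `R`-integral equation stays `R'`-integral; first line of the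
proof of Silverman AEC VII.5.4 (a)). [cite: SilvermanAEC2009, Prop. VII.5.4 (a) with proof (p. 197)] -/
theorem isIntegral_map_hom (X : WeierstrassCurve K₁) [hX : IsIntegral R₁ X] :
    IsIntegral R₂ (X.map g) := by
  obtain ⟨M, hM⟩ := hX.integral
  refine ⟨⟨M.map f, ?_⟩⟩
  rw [hM, baseChange, baseChange, map_map, map_map, comp_algebraMap_eq_of_compat f g hc]

omit [IsDomain R₁] [IsDiscreteValuationRing R₁] [IsFractionRing R₁ K₁] [IsDomain R₂]
  [IsDiscreteValuationRing R₂] in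
include hc in
/-- Integral models are transported along compatible `(f, g)`: the (unique) integral model of
`g M` is `f` of the integral model of `M` (base change to `K₂` is injective). [folklore] -/
private theorem integralModel_map_eq_map_integralModel_hom (M : WeierstrassCurve K₁) [IsIntegral R₁ M]
    [IsIntegral R₂ (M.map g)] :
    integralModel R₂ (M.map g) = (integralModel R₁ M).map f := by
  apply map_injective (IsFractionRing.injective R₂ K₂)
  have h₂ := baseChange_integralModel_eq R₂ (M.map g)
  have h₁ := baseChange_integralModel_eq R₁ M
  rw [WeierstrassCurve.baseChange] at h₂ h₁
  change (integralModel R₂ (M.map g)).map (algebraMap R₂ K₂) =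
    ((integralModel R₁ M).map f).map (algebraMap R₂ K₂)
  rw [h₂, map_map, ← comp_algebraMap_eq_of_compat f g hc, ← map_map, h₁]

/-- In the value group `ℤᵐ⁰` of a DVR: an element of `K` of valuation `< 1` has valuation
`≤ exp (-1)` (discreteness). [folklore] -/
private theorem valuation_le_exp_neg_one_of_lt_one {x : K₂}
    (hx : valuation K₂ (IsDiscreteValuationRing.maximalIdeal R₂) x < 1) :
    valuation K₂ (IsDiscreteValuationRing.maximalIdeal R₂) x ≤ WithZero.exp (-1 : ℤ) := by
  obtain ⟨a, rfl⟩ := IsDiscreteValuationRing.exists_lift_of_le_one (A := R₂) hx.le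
  rw [valuation_of_algebraMap] at hx ⊢
  have hmem : a ∈ (IsDiscreteValuationRing.maximalIdeal R₂).asIdeal := (intValuation_lt_one_iff_mem _ a).mp hx
  have h := (intValuation_le_pow_iff_mem (IsDiscreteValuationRing.maximalIdeal R₂) a 1).mpr
    (by rwa [pow_one])
  simpa using h

/-- If `v (algebraMap a) ≤ exp (-i)` then `πⁱ ∣ a`. [folklore] -/
private theorem uniformizer_pow_dvd_of_valuation_le {a : R₂} {i : ℕ}
    (h : valuation K₂ (IsDiscreteValuationRing.maximalIdeal R₂) (algebraMap R₂ K₂ a) ≤ WithZero.exp (-(i : ℤ))) :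
    uniformizer R₂ ^ i ∣ a := by
  rw [valuation_of_algebraMap, intValuation_le_pow_iff_mem]
    at h
  exact mem_maximalIdeal_pow_iff_dvd.mp h

include hc in
/-- **Silverman, AEC Prop. VII.5.4 (a) in every residue characteristic: a minimal Weierstrass
equation stays minimal under an unramified extension of the discrete valuation ring** ("Let
`K'/K` be an unramified extension … Hence the original equation is also minimal over `K'`"; the
book proves it for residue characteristic `≥ 5` by the `v(Δ) < 12` / `v(c₄) < 4` criterion and
defers the general case: "For arbitrary characteristic this follows from Tate's algorithm; see
[ATAEC, IV §9] or [Tate]" — re-proved here for EVERY residue characteristic through Step 11 read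
forwards (`kodairaSymbolOfMinimal_eq_I_zero_of_pow_dvd`) and the coupling
`kodairaSymbolOfMinimal_map_of_map_uniformizer`; the printed all-characteristic source for
minimality under étale base change is Liu 2002, Prop. 10.1.17 with Cor. 9.4.38).  Setting: `f : R₁ →+* R₂` with `f π₁ = w π₂`,
`g : K₁ →+* K₂` compatible, perfect residue fields, `X` over `K₁` minimal w.r.t. `R₁` with `Δ ≠ 0`.
Proof via Step 11 of Tate's algorithm: were `g X` not minimal, Mathlib's `IsMinimal` would give
`C = (u; r, s, t)` over `K₂` with `C • g X` integral and `v(u) < 1`; `r, s, t ∈ R₂` by AEC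
VII.1.3 (b) (`valuation_r/s/t_le_one_of_isIntegral_of_le`), so the translated integral model `(1; r, s, t) • f M` of the integral minimal
model `M` of `X` satisfies `πⁱ ∣ aᵢ`; by `kodairaSymbolOfMinimal_eq_I_zero_of_pow_dvd` the algorithm returns the junk `I₀` on `f M`, hence
(`kodairaSymbolOfMinimal_map_of_map_uniformizer`) on `M` — impossible for a minimal `M` with
`π ∣ Δ` (`kodairaSymbolOfMinimal_ne_I_zero`); and if `π ∤ Δ(M)` then `v(Δ(g X)) = 1` is already
maximal. [cite: SilvermanAEC2009, Prop. VII.5.4 (a) with proof (p. 197)] [cite: SilvermanATAEC1994, IV.9.4 Step 11 (PDF pp. 346, 354–355)]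
[cite: Liu2002, Prop. 10.1.17 with Cor. 9.4.38] -/
theorem isMinimal_map_of_map_uniformizer [PerfectField (IsLocalRing.ResidueField R₁)]
    [PerfectField (IsLocalRing.ResidueField R₂)] {w : R₂ˣ} (hw : f (uniformizer R₁) = ↑w * uniformizer R₂)
    (X : WeierstrassCurve K₁) [hX : IsMinimal R₁ X] (hΔ : X.Δ ≠ 0) :
    IsMinimal R₂ (X.map g) := by
  classical
  haveI hint : IsIntegral R₂ (X.map g) := isIntegral_map_hom f g hc X
  refine ⟨⟨by simpa using hint, fun C hC hle ↦ ?_⟩⟩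
  dsimp only at hC hle ⊢
  rw [one_smul] at hle ⊢
  haveI : IsIntegral R₂ (C • X.map g) := hC
  by_contra hlt
  have hlt₀ : (valuation_Δ_aux R₂ (X.map g) : WithZero (Multiplicative ℤ)) < valuation_Δ_aux R₂ (C • X.map g) :=
    lt_of_not_ge hlt
  rw [valuation_Δ_aux_eq_of_isIntegral, valuation_Δ_aux_eq_of_isIntegral] at hlt₀
  have hlt' := hlt₀
  rw [variableChange_Δ, map_mul, map_pow, map_units_inv] at hlt'
  -- notation
  set v₂ := valuation K₂ (IsDiscreteValuationRing.maximalIdeal R₂) with hv₂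
  set M := integralModel R₁ X with hM
  have hXM : X = M.baseChange K₁ := (baseChange_integralModel_eq R₁ X).symm
  have hΔM : M.Δ ≠ 0 := by
    intro h0; apply hΔ; rw [← integralModel_Δ_eq R₁ X, ← hM, h0, map_zero]
  have hΔg : (X.map g).Δ = algebraMap R₂ K₂ (f M.Δ) := by
    rw [map_Δ, hXM, baseChange, map_Δ, hc]
  have hd0 : v₂ (X.map g).Δ ≠ 0 :=
    (Valuation.ne_zero_iff _).mpr (by rw [map_Δ]; exact (map_ne_zero_iff _ g.injective).mpr hΔ)
  -- `v(u) < 1`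
  have hu1 : v₂ (C.u : K₂) < 1 := by
    by_contra hge
    rw [not_lt] at hge
    have hu0' : 0 < v₂ (C.u : K₂) :=
      zero_lt_iff.mpr ((Valuation.ne_zero_iff _).mpr (Units.ne_zero _))
    have hinv : (v₂ (C.u : K₂))⁻¹ ^ 12 ≤ 1 := pow_le_one₀ zero_le ((inv_le_one₀ hu0').mpr hge)
    have : (v₂ (C.u : K₂))⁻¹ ^ 12 * v₂ (X.map g).Δ ≤ v₂ (X.map g).Δ := by
      calc (v₂ (C.u : K₂))⁻¹ ^ 12 * v₂ (X.map g).Δ ≤ 1 * v₂ (X.map g).Δ :=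
            mul_le_mul_left hinv _
        _ = v₂ (X.map g).Δ := one_mul _
    exact absurd hlt' (not_lt.mpr this)
  have hu : v₂ (C.u : K₂) ≤ 1 := hu1.le
  have hue : v₂ (C.u : K₂) ≤ WithZero.exp (-1 : ℤ) := valuation_le_exp_neg_one_of_lt_one hu1
  -- `r, s, t ∈ R₂`
  have hr := valuation_r_le_one_of_isIntegral_of_le R₂ (W₁ := X.map g) (W₂ := C • X.map g) rfl hu
  have hs := valuation_s_le_one_of_isIntegral_of_le R₂ (W₁ := X.map g) (W₂ := C • X.map g) rfl hu hr
  have ht := valuation_t_le_one_of_isIntegral_of_le R₂ (W₁ := X.map g) (W₂ := C • X.map g) rfl hu hr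
  obtain ⟨r₀, hr₀⟩ := IsDiscreteValuationRing.exists_lift_of_le_one (A := R₂) hr
  obtain ⟨s₀, hs₀⟩ := IsDiscreteValuationRing.exists_lift_of_le_one (A := R₂) hs
  obtain ⟨t₀, ht₀⟩ := IsDiscreteValuationRing.exists_lift_of_le_one (A := R₂) ht
  -- the translated integral model `T • N`, `N = f M` the integral model of `g X`
  set N := integralModel R₂ (X.map g) with hN
  have hNM : N = M.map f := integralModel_map_eq_map_integralModel_hom f g hc X
  set T : VariableChange R₂ := ⟨1, r₀, s₀, t₀⟩ with hT
  have hTK : T.map (algebraMap R₂ K₂) = (⟨1, C.r, C.s, C.t⟩ : VariableChange K₂) := by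
    ext <;> simp [hT, VariableChange.map, hr₀, hs₀, ht₀]
  have hTN : (T • N).map (algebraMap R₂ K₂) = (⟨1, C.r, C.s, C.t⟩ : VariableChange K₂) • X.map g := by
    rw [← map_variableChange, hTK, hN]
    exact congrArg _ (baseChange_integralModel_eq R₂ (X.map g))
  have hfac : C • X.map g =
      (⟨C.u, 0, 0, 0⟩ : VariableChange K₂) • (T • N).map (algebraMap R₂ K₂) := by
    rw [hTN, smul_eq_rescale_smul C (X.map g)]
  -- `πⁱ ∣ aᵢ (T • N)`: `(u; 0,0,0) • (T • N)` is integral and `v(u) ≤ exp (-1)`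
  have hu0 : v₂ (C.u : K₂) ≠ 0 := (Valuation.ne_zero_iff _).mpr (Units.ne_zero _)
  have hexp : ∀ i : ℕ, (WithZero.exp (-1 : ℤ)) ^ i = WithZero.exp (-(i : ℤ)) := by
    intro i; rw [← WithZero.exp_nsmul]; congr 1; simp
  have key : ∀ (i : ℕ) {a : R₂} {b : K₂}, b = ((C.u⁻¹ : K₂ˣ) : K₂) ^ i * algebraMap R₂ K₂ a →
      v₂ b ≤ 1 → uniformizer R₂ ^ i ∣ a := by
    intro i a b hb hb1
    apply uniformizer_pow_dvd_of_valuation_le (K₂ := K₂)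
    have ha : algebraMap R₂ K₂ a = (C.u : K₂) ^ i * b := by
      rw [hb, ← mul_assoc, ← mul_pow, Units.mul_inv, one_pow, one_mul]
    rw [← hv₂]
    calc v₂ (algebraMap R₂ K₂ a) = v₂ (C.u : K₂) ^ i * v₂ b := by rw [ha, map_mul, map_pow]
      _ ≤ v₂ (C.u : K₂) ^ i := mul_le_of_le_one_right' hb1
      _ ≤ (WithZero.exp (-1 : ℤ)) ^ i := pow_le_pow_left' hue i
      _ = WithZero.exp (-(i : ℤ)) := hexp i
  have int₁ : v₂ (C • X.map g).a₁ ≤ 1 := by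
    rw [← integralModel_a₁_eq R₂ (C • X.map g)]; exact valuation_le_one _ _
  have int₂ : v₂ (C • X.map g).a₂ ≤ 1 := by
    rw [← integralModel_a₂_eq R₂ (C • X.map g)]; exact valuation_le_one _ _
  have int₃ : v₂ (C • X.map g).a₃ ≤ 1 := by
    rw [← integralModel_a₃_eq R₂ (C • X.map g)]; exact valuation_le_one _ _
  have int₄ : v₂ (C • X.map g).a₄ ≤ 1 := by
    rw [← integralModel_a₄_eq R₂ (C • X.map g)]; exact valuation_le_one _ _
  have int₆ : v₂ (C • X.map g).a₆ ≤ 1 := by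
    rw [← integralModel_a₆_eq R₂ (C • X.map g)]; exact valuation_le_one _ _
  have h1 : uniformizer R₂ ∣ (T • N).a₁ := by
    have := key 1 (a := (T • N).a₁) (b := (C • X.map g).a₁)
      (by rw [hfac, rescale_a₁, map_a₁, pow_one]) int₁
    rwa [pow_one] at this
  have h2 : uniformizer R₂ ^ 2 ∣ (T • N).a₂ :=
    key 2 (a := (T • N).a₂) (b := (C • X.map g).a₂) (by rw [hfac, rescale_a₂, map_a₂]) int₂
  have h3 : uniformizer R₂ ^ 3 ∣ (T • N).a₃ :=
    key 3 (a := (T • N).a₃) (b := (C • X.map g).a₃) (by rw [hfac, rescale_a₃, map_a₃]) int₃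
  have h4 : uniformizer R₂ ^ 4 ∣ (T • N).a₄ :=
    key 4 (a := (T • N).a₄) (b := (C • X.map g).a₄) (by rw [hfac, rescale_a₄, map_a₄]) int₄
  have h6 : uniformizer R₂ ^ 6 ∣ (T • N).a₆ :=
    key 6 (a := (T • N).a₆) (b := (C • X.map g).a₆) (by rw [hfac, rescale_a₆, map_a₆]) int₆
  -- Step 11 on `N = f M`, transported to `M`
  have hN0 : N.kodairaSymbolOfMinimal = .I 0 :=
    kodairaSymbolOfMinimal_eq_I_zero_of_pow_dvd N T h1 h2 h3 h4 h6
  rw [hNM, kodairaSymbolOfMinimal_map_of_map_uniformizer f hw] at hN0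
  by_cases hm : M.Δ ∈ IsLocalRing.maximalIdeal R₁
  · have hmin : (M.baseChange K₁).IsMinimal R₁ := by rw [← hXM]; exact hX
    exact kodairaSymbolOfMinimal_ne_I_zero K₁ hΔM hmin hm hN0
  · have hm' : f M.Δ ∉ IsLocalRing.maximalIdeal R₂ :=
      fun h ↦ hm ((hom_mem_maximalIdeal_iff f hw _).mp h)
    have h1' : v₂ (X.map g).Δ = 1 := by
      rw [hΔg, hv₂, valuation_of_algebraMap]
      refine le_antisymm (intValuation_le_one _ _) (not_lt.mp fun hlt2 ↦ hm' ?_)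
      exact (intValuation_lt_one_iff_mem _ _).mp hlt2
    have hle1 : v₂ (C • X.map g).Δ ≤ 1 := by
      rw [← integralModel_Δ_eq R₂ (C • X.map g)]; exact valuation_le_one _ _
    rw [h1'] at hlt₀
    exact absurd hlt₀ (not_lt.mpr hle1)

end Transport

/-! ### §2 The Kodaira symbol and `ord Δ_min` over the fraction fields -/

section Fraction

variable {R₁ K₁ R₂ K₂ : Type*}
  [CommRing R₁] [IsDomain R₁] [IsDiscreteValuationRing R₁] [Field K₁] [Algebra R₁ K₁]
  [IsFractionRing R₁ K₁]
  [CommRing R₂] [IsDomain R₂] [IsDiscreteValuationRing R₂] [Field K₂] [Algebra R₂ K₂]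
  [IsFractionRing R₂ K₂]
  (f : R₁ →+* R₂) (g : K₁ →+* K₂)
  (hc : ∀ r : R₁, g (algebraMap R₁ K₁ r) = algebraMap R₂ K₂ (f r))
  {w : R₂ˣ} (hw : f (uniformizer R₁) = ↑w * uniformizer R₂)

open IsDiscreteValuationRing IsDedekindDomain.HeightOneSpectrum

include hc hw in
/-- **The Kodaira symbol is unchanged under unramified extension** (fraction-field level, perfect
residue fields): for `X / K₁` with `Δ ≠ 0`, Tate's algorithm over `R₂` on `g X` returns the
Kodaira symbol of `X` over `R₁`.  `(g X).minimal R₂` and `g (X.minimal R₁)` are both minimal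
(`isMinimal_map_of_map_uniformizer`), so their integral models differ by a change of variables
over `R₂` (Silverman AEC VII.1.3 (b), `exists_variableChange_integralModel_eq`) and
`kodairaSymbolOfMinimal_smul` applies; the integral model of `g (X.minimal R₁)` is `f` of that of
`X.minimal R₁`, to which `kodairaSymbolOfMinimal_map_of_map_uniformizer` applies.  Silverman,
*AEC* Prop. VII.5.4 (a); ATAEC IV.9.4; Tate, LNM 476 (through ATAEC IV.9.4).
[cite: SilvermanAEC2009, Prop. VII.5.4 (a) with proof (p. 197)] [cite: SilvermanATAEC1994, IV.9.4 (PDF pp. 344–346)] -/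
theorem kodairaSymbol_map_of_map_uniformizer [PerfectField (IsLocalRing.ResidueField R₁)]
    [PerfectField (IsLocalRing.ResidueField R₂)] (X : WeierstrassCurve K₁) (hΔ : X.Δ ≠ 0) :
    (X.map g).kodairaSymbol R₂ = X.kodairaSymbol R₁ := by
  unfold kodairaSymbol
  set C₁ := (X.exists_isMinimal R₁).choose
  set C₂ := ((X.map g).exists_isMinimal R₂).choose
  have hM₁ : X.minimal R₁ = C₁ • X := rfl
  have hM₂ : (X.map g).minimal R₂ = C₂ • X.map g := rfl
  have hΔ₁ : (X.minimal R₁).Δ ≠ 0 := by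
    rw [hM₁, variableChange_Δ]
    exact mul_ne_zero (pow_ne_zero _ (Units.ne_zero _)) hΔ
  haveI hmin₁ : IsMinimal R₂ ((X.minimal R₁).map g) :=
    isMinimal_map_of_map_uniformizer f g hc hw _ hΔ₁
  have hrel : (X.map g).minimal R₂ = (C₂ * (C₁.map g)⁻¹) • (X.minimal R₁).map g := by
    rw [hM₂, hM₁, ← map_variableChange, smul_smul, inv_mul_cancel_right]
  have hΔ' : ((X.minimal R₁).map g).Δ ≠ 0 := by
    rw [map_Δ]; exact (map_ne_zero_iff _ g.injective).mpr hΔ₁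
  obtain ⟨D', -, hD'⟩ := exists_variableChange_integralModel_eq R₂ hrel hΔ'
  rw [hD', kodairaSymbolOfMinimal_smul, integralModel_map_eq_map_integralModel_hom f g hc,
    kodairaSymbolOfMinimal_map_of_map_uniformizer f hw]

include hc hw in
/-- The (truncated) discriminant valuation `valuation_Δ_aux` of an `R₁`-integral equation is
unchanged along an unramified `(f, g)` (`ord₂ (f a) = ord₁ a`, Silverman's `v(Δ) = v'(Δ)`).
[cite: SilvermanAEC2009, Prop. VII.5.4 (a) with proof (p. 197)] -/
theorem valuation_Δ_aux_map_of_map_uniformizer (X : WeierstrassCurve K₁) [IsIntegral R₁ X] :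
    (valuation_Δ_aux R₂ (X.map g) : WithZero (Multiplicative ℤ)) = valuation_Δ_aux R₁ X := by
  haveI := isIntegral_map_hom f g hc X
  rw [valuation_Δ_aux_eq_of_isIntegral, valuation_Δ_aux_eq_of_isIntegral, valuation_Δ_eq_addVal,
    valuation_Δ_eq_addVal, integralModel_map_eq_map_integralModel_hom f g hc, map_Δ,
    addVal_hom f hw]

include hc hw in
/-- **`ord Δ_min` is unchanged under unramified extension** (fraction-field level): the additive
valuation of the discriminant of the integral model of Mathlib's chosen minimal equation of `g X`
over `R₂` equals that of `X` over `R₁` (the two chosen minimal equations need not correspond,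
but both `(g X).minimal R₂` and `g (X.minimal R₁)` are minimal, so their discriminant
valuations agree, `valuation_Δ_aux_eq_of_isMinimal`; and `ord₂ (f a) = ord₁ a`).  Silverman,
*AEC* Prop. VII.5.4 (a): "`v(Δ) = v'(Δ)` … the original equation is also minimal over `K'`".
[cite: SilvermanAEC2009, Prop. VII.5.4 (a) with proof (p. 197)] -/
theorem addVal_Δ_minimal_map_of_map_uniformizer [PerfectField (IsLocalRing.ResidueField R₁)]
    [PerfectField (IsLocalRing.ResidueField R₂)] (X : WeierstrassCurve K₁) (hΔ : X.Δ ≠ 0) :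
    addVal R₂ ((((X.map g).minimal R₂).integralModel R₂).Δ) =
      addVal R₁ (((X.minimal R₁).integralModel R₁).Δ) := by
  set C₁ := (X.exists_isMinimal R₁).choose
  set C₂ := ((X.map g).exists_isMinimal R₂).choose
  have hM₁ : X.minimal R₁ = C₁ • X := rfl
  have hM₂ : (X.map g).minimal R₂ = C₂ • X.map g := rfl
  have hΔ₁ : (X.minimal R₁).Δ ≠ 0 := by
    rw [hM₁, variableChange_Δ]
    exact mul_ne_zero (pow_ne_zero _ (Units.ne_zero _)) hΔ
  have hmin₁ : IsMinimal R₂ ((X.minimal R₁).map g) :=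
    isMinimal_map_of_map_uniformizer f g hc hw _ hΔ₁
  have hmin₂ : IsMinimal R₂ ((X.map g).minimal R₂) := inferInstance
  have hrel : (X.map g).minimal R₂ = (C₂ * (C₁.map g)⁻¹) • (X.minimal R₁).map g := by
    rw [hM₂, hM₁, ← map_variableChange, smul_smul, inv_mul_cancel_right]
  have hval := congrArg Subtype.val (valuation_Δ_aux_eq_of_isMinimal hmin₁ hmin₂ _ hrel)
  rw [valuation_Δ_aux_map_of_map_uniformizer f g hc hw,
    valuation_Δ_aux_eq_of_isIntegral, valuation_Δ_aux_eq_of_isIntegral,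
    valuation_Δ_eq_addVal, valuation_Δ_eq_addVal] at hval
  exact Literature.NumberTheory.DiophantineGeometry.MinimalDiscriminant.eq_of_recTopCoe_inv_eq hval

include hc hw in
/-- `addVal_Δ_minimal_map_of_map_uniformizer` with the target curve abstracted (avoids rewriting
under the `IsIntegral` instance argument of `integralModel`). [cite: SilvermanAEC2009, Prop. VII.5.4 (a) with proof (p. 197)] -/
theorem addVal_Δ_minimal_eq_of_eq_map [PerfectField (IsLocalRing.ResidueField R₁)]
    [PerfectField (IsLocalRing.ResidueField R₂)] (X : WeierstrassCurve K₁) (hΔ : X.Δ ≠ 0)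
    {Y : WeierstrassCurve K₂} (hY : Y = X.map g) :
    addVal R₂ (((Y.minimal R₂).integralModel R₂).Δ) =
      addVal R₁ (((X.minimal R₁).integralModel R₁).Δ) := by
  subst hY
  exact addVal_Δ_minimal_map_of_map_uniformizer f g hc hw X hΔ

include hc hw in
/-- `kodairaSymbol_map_of_map_uniformizer` with the target curve abstracted (the reduction type
over `K'` is that over `K`). [cite: SilvermanAEC2009, Prop. VII.5.4 (a) with proof (p. 197)] [cite: SilvermanATAEC1994, IV.9.4 (PDF pp. 344–346)] -/
theorem kodairaSymbol_eq_of_eq_map [PerfectField (IsLocalRing.ResidueField R₁)]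
    [PerfectField (IsLocalRing.ResidueField R₂)] (X : WeierstrassCurve K₁) (hΔ : X.Δ ≠ 0)
    {Y : WeierstrassCurve K₂} (hY : Y = X.map g) :
    Y.kodairaSymbol R₂ = X.kodairaSymbol R₁ := by
  subst hY
  exact kodairaSymbol_map_of_map_uniformizer f g hc hw X hΔ

end Fraction

end WeierstrassCurve
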